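import Summits.BirchSwinnertonDyer.BirchSwinnertonDyer.Theorems.SignedBaseChangeAnticyclotomicEisensteinDivisibilityXAcTorsionSignedCarrierLocal
import Summits.BirchSwinnertonDyer.BirchSwinnertonDyer.Theorems.KatoDescentPotSupersingularSelmerInftyDirectLimit
import HarnessLib

/-!
# Stub (a) `stub_xAcTorsionSS` of line `bdpline` (crux `AnticyclotomicEisensteinDivisibility`,
# stmt-BirchSwinnertonDyer-20727) — helper 2b: the two transcriptions of the signed Selmer group over a
# `ℤ_p`-extension COINCIDE: `AcSigned.selmer W p κ ∅ (±) = Kobayashi2003.signedSelmerInfty W κ ±`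

Width seat bsd-line-sbc-p1-w4 (gen 0), `--supports stmt-BirchSwinnertonDyer-20727`. The tree carries the
signed (plus/minus) Selmer group of an elliptic curve over a `ℤ_p`-extension `K_∞/K` in two models:
* `Kobayashi2003.signedSelmerInfty W κ ε = ⨆ₙ res (Sel^ε(E/K_n))` — the DIRECT LIMIT of the layer groups
  (Kobayashi Def. 1.1; Iovita–Pollack Def. 6.7; the carrier of the REFEREED rank-one theorem
  `AcSigned.longoVigni2019_thm14_signedSelmerDual_rank_one`);
* `AcSigned.selmer W p κ ∅ (fun _ ↦ .sgn ε)` — cut out DIRECTLY over `K_∞` by B.-D. Kim's `K_∞`-level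
  condition `ℋ^ε_w = ⋃ₙ E^ε(K_{n,w}) ⊗ ℚ_p/ℤ_p` above `p` and the strict condition away from `p`
  (Castella–Wan Def. 5.1 `Sel^{±,±}(K, 𝐀^ac)`; the carrier of the tree's transfer theorem
  `AcSigned.TransferInputs.isFGTorsion_and_sq_mem_charIdeal` and of helper 1
  `…XAcTorsionTransfer`), the reading flag `away-p` of `AnticyclotomicSignedSelmer.lean` recording that
  their identity was NOT proved.
This file PROVES the identity (for `p` odd and under "`E(K_{∞,w})[p^∞] = 0` at every `w ∣ p`", the
standing fact of the supersingular setting — B.-D. Kim 2013 Prop. 3.2 / Iovita–Pollack Lemma 2.1, PROVED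
in the tree for `AcSigned.Setting`: `fixedPoints_decomp_inf_kerSubgroup_geomPrimaryTorsion_eq_bot_of_setting`):
* (sibling file `…XAcTorsionSignedCarrierLocal.lean`) `signedSelmerInfty_le_selmer_sgn` (`⊇`, odd
  `p`) and the local descent step above `p`;
* §2 (here) `selmer_sgn_le_signedSelmerInfty` (`⊆`): a class `c` of `Sel^{±}(K_∞)` in Kim's model is classical
  over `K_∞`, so `c = res y` with `y` classical at a layer `K_m` for the bad places (Greenberg's Lemmas
  3.2/3.3 + compactness, verbatim the descent of `Kobayashi2003.fineSelmerInfty_le_signedSelmerInfty`);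
  ABOVE `p` the Kummer datum of `c` (`φ₀ = ∂Q` on `Gal(K̄_v/K_{∞,w})`, `pᵏQ ∈ E^ε(K_{n₀,w})`) and the
  classical datum of `y` (`φ = ∂P` on `Gal(K̄_v/K_{m,w})`) differ by a point `R = P − Q − t` FIXED by
  `Gal(K̄_v/K_{∞,w})`; for `τ ∈ Gal(K̄_v/K_{m,w})`, `τR − R` is a `p`-power torsion point fixed by
  `Gal(K̄_v/K_{∞,w})`, hence `0` by the no-`p`-torsion hypothesis — so `φ = ∂(Q + t)` on the whole layer
  group and `y ∈ Sel^ε(E/K_m)` (Kobayashi's Kummer condition with the point `Q + t`);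
* §3 `selmer_sgn_eq_signedSelmerInfty`.
Kernel plumbing between two existing tree objects; no definition, no named fact; nothing about BSD.

References: [Kobayashi2003] Def. 1.1; [BDKim2013] Def. 3.1/3.3, Prop. 3.2; [IovitaPollack2006] Def. 6.7,
Lemma 2.1; [CastellaWan2023] Def. 5.1 (MS p. 23); [GreenbergLNM1716] §2 Prop. 2.1, §3 Lemmas 3.2–3.3.
-/

-- D-0017: single-problem summit, the namespace repeats the problem name by design.
set_option linter.dupNamespace false
set_option autoImplicit false

noncomputable section

open scoped Classical

universe u

namespace Summit.BirchSwinnertonDyer.BirchSwinnertonDyer.Theorems.SignedBaseChangeAcDivXAcTorsionCarrier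

open NumberField IsDedekindDomain Field Filter Topology
open Literature.NumberTheory.EllipticCurves Literature.NumberTheory.EllipticCurves.GreenbergSelmer
  Literature.NumberTheory.GaloisRepresentations WeierstrassCurve ZpExtension
  Literature.NumberTheory.EllipticCurves.Kobayashi2003 Literature.NumberTheory.EllipticCurves.AcSigned
  Summit.BirchSwinnertonDyer.BirchSwinnertonDyer.Theorems.AlignedTransportAtTwoFineRoad

variable {K : Type u} [Field K] [NumberField K] (W : WeierstrassCurve K) {p : ℕ} [Fact p.Prime]
  (κ : ZpExtension K p)

/-! ## §2 (global) `Sel^{±}(K_∞) ≤ lim→ Sel^ε(E/K_n)` under `E(K_{∞,w})[p^∞] = 0` at `w ∣ p` -/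

/-- Finite uniformisation (bookkeeping): finitely many monotone eventually-true properties of the layer
index hold simultaneously at one layer. [folklore] -/
private theorem exists_forall_of_finite' {ι : Type*} [Finite ι] {P : ι → ℕ → Prop} (n : ℕ)
    (hmono : ∀ i {m m' : ℕ}, m ≤ m' → P i m → P i m') (h : ∀ i, ∃ m, n ≤ m ∧ P i m) :
    ∃ m, n ≤ m ∧ ∀ i, P i m := by
  classical
  haveI := Fintype.ofFinite ι
  choose f hf using h
  refine ⟨max n (Finset.univ.sup f), le_max_left _ _, fun i ↦ hmono i ?_ (hf i).2⟩
  exact (Finset.le_sup (f := f) (Finset.mem_univ i)).trans (le_max_right _ _)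

/-- **`⊆`: Kim's `K_∞`-level signed Selmer group lies in Kobayashi's direct limit**, for every
elliptic `W/K`, every `ℤ_p`-extension `κ` and sign `ε`, PROVIDED `E[p^∞]` has no non-zero point fixed by
`D_v ⊓ Gal(K̄/K_∞)` at every `v ∣ p` (`E(K_{∞,w})[p^∞] = 0`; B.-D. Kim 2013 Prop. 3.2 / Iovita–Pollack
Lemma 2.1, PROVED in the tree in `AcSigned.Setting`). Proof: a class `c` of Kim's group is classical over
`K_∞` (`selmer_sgn_le_selmerInfty`), hence `c = res y` with `y ∈ Sel_{p^∞}(E/K_n)` (the tree's direct-limit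
theorem `FineSelmerLeSignedSelmer.mem_selmerInfty_iff_exists_layer`); at each of the finitely many
(conjugate, prime above `p`) the `K_∞`-level Kummer datum of `c` descends to Kobayashi's layer condition
from one layer on (`resOfLe_mem_localKummerOverOfEmb_of_kummer_data`); restriction preserves the
classical conditions (`resOfLe_mem_selmerGroupOver`). [cite: Kobayashi2003, Def. 1.1]
[cite: BDKim2013, Def. 3.1, Def. 3.3, Prop. 3.2 (pp. 192–193)] [cite: GreenbergLNM1716, §3 Lemma 3.2 (p. 86)] -/
theorem selmer_sgn_le_signedSelmerInfty [W.IsElliptic] (ε : ℤˣ)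
    (hNT : ∀ v : HeightOneSpectrum (𝓞 K), ((p : ℕ) : 𝓞 K) ∈ v.asIdeal →
      FixedPoints.addSubgroup ↥(decomp v ⊓ κ.kerSubgroup) (W.geomPrimaryTorsion p) = ⊥) :
    AcSigned.selmer W p κ ∅ (fun _ ↦ .sgn ε) ≤ signedSelmerInfty W κ ε := by
  classical
  intro c hc
  have hsel := (mem_selmer_iff c).1 hc
  have hc' : c ∈ W.selmerInfty κ := selmer_sgn_le_selmerInfty W κ ε hc
  -- the no-`p`-torsion hypothesis in the local form of the descent lemma
  have hNT' : ∀ (v : HeightOneSpectrum (𝓞 K)), ((p : ℕ) : 𝓞 K) ∈ v.asIdeal →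
      ∀ s : W.geomPrimaryTorsion p,
        (∀ σ : absoluteGaloisGroup (v.adicCompletion K),
          σ ∈ localSubgroupOfEmb κ.kerSubgroup (closureEmb (K := K) (v.adicCompletion K)) →
            resGalOfEmb (closureEmb (K := K) (v.adicCompletion K)) σ • s = s) → s = 0 := by
    intro v hv s hs
    have hmem : s ∈ FixedPoints.addSubgroup ↥(decomp v ⊓ κ.kerSubgroup) (W.geomPrimaryTorsion p) := by
      refine (FixedPoints.mem_addSubgroup _ _ s).mpr fun g ↦ ?_
      obtain ⟨hgD, hgK⟩ := Subgroup.mem_inf.1 g.2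
      obtain ⟨σ, hσg⟩ := (mem_decomp_iff v _).1 hgD
      have hσg' : resGalOfEmb (closureEmb (K := K) (v.adicCompletion K)) σ =
          (g : absoluteGaloisGroup K) := by
        change resGal (K := K) (v.adicCompletion K) σ = _
        rw [WeierstrassCurve.resGal_eq_absGaloisRestrict]; exact hσg
      have hσ : σ ∈ localSubgroupOfEmb κ.kerSubgroup (closureEmb (K := K) (v.adicCompletion K)) := by
        rw [mem_localSubgroupOfEmb_iff, hσg']; exact hgK
      rw [Subgroup.smul_def, ← hσg']
      exact hs σ hσ
    rw [hNT v hv, AddSubgroup.mem_bot] at hmem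
    exact hmem
  -- (1) `c = h_n y` with `y ∈ Sel_{p^∞}(E/K_n)` (classical direct limit)
  obtain ⟨n, y, hy, rfl⟩ := (FineSelmerLeSignedSelmer.mem_selmerInfty_iff_exists_layer W κ c).1 hc'
  have hy' := (W.mem_selmerGroupOver_iff p (κ.layerSubgroup n) y).1 hy
  -- (2) the classes `conj_σ y` through the finite quotient `Γ_K / Γ_n`
  haveI : Finite (absoluteGaloisGroup K ⧸ κ.layerSubgroup n) :=
    Subgroup.quotient_finite_of_isOpen _ (κ.isOpen_layerSubgroup n)
  have hconj_rep : ∀ σ : absoluteGaloisGroup K, W.conjH1 p (κ.layerSubgroup n) σ y =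
      W.conjH1 p (κ.layerSubgroup n)
        ((σ : absoluteGaloisGroup K ⧸ κ.layerSubgroup n).out) y := by
    intro σ
    obtain ⟨h, hh⟩ := QuotientGroup.mk_out_eq_mul (κ.layerSubgroup n) σ
    rw [hh, W.conjH1_mul_holds p (κ.layerSubgroup n) σ h, AddMonoidHom.comp_apply,
      W.conjH1_of_mem_holds p (κ.layerSubgroup n) h.2, AddMonoidHom.id_apply]
  choose φ hφ using fun q : absoluteGaloisGroup K ⧸ κ.layerSubgroup n ↦
    oneCocycleClass_surjective (discreteTopRep (κ.layerSubgroup n) (W.geomPrimaryTorsion p))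
      (W.conjH1 p (κ.layerSubgroup n) q.out y)
  -- (3) the finitely many primes above `p`
  have hPfin : Set.Finite {v : HeightOneSpectrum (𝓞 K) | ((p : ℕ) : 𝓞 K) ∈ v.asIdeal} := by
    have hp : Ideal.span {((p : ℕ) : 𝓞 K)} ≠ ⊥ := by
      rw [Ne, Ideal.span_singleton_eq_bot]
      exact Nat.cast_ne_zero.mpr (Fact.out : p.Prime).ne_zero
    exact (Ideal.finite_factors hp).subset fun v hv ↦ Ideal.dvd_span_singleton.mpr hv
  -- (4) the `K_∞`-level Kummer datum of `conj_q c` at `v ∣ p`, compared with the cocycle `φ q`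
  have hK : ∀ (q : absoluteGaloisGroup K ⧸ κ.layerSubgroup n) (v : hPfin.toFinset),
      ∃ (n₀ : ℕ) (φ₀ : contOneCocycles (discreteTopRep κ.kerSubgroup (W.geomPrimaryTorsion p)))
        (Q : localPoints W (v.1.adicCompletion K)) (k : ℕ) (t : W.geomPrimaryTorsion p),
        p ^ k • Q ∈ signedLocalPointsOfEmb κ (closureEmb (K := K) (v.1.adicCompletion K)) W ε n₀ ∧
        (∀ τ : localSubgroupOfEmb κ.kerSubgroup (closureEmb (K := K) (v.1.adicCompletion K)),
          pointsMapOfEmb W (closureEmb (K := K) (v.1.adicCompletion K))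
              ((φ₀.1 (resGalSubgroupOfEmb κ.kerSubgroup (closureEmb (K := K) (v.1.adicCompletion K)) τ) :
                  W.geomPrimaryTorsion p) : W.geomPoints) =
            (τ : absoluteGaloisGroup (v.1.adicCompletion K)) • Q - Q) ∧
        ∀ (g : absoluteGaloisGroup K) (hg : g ∈ κ.layerSubgroup n) (hg' : g ∈ κ.kerSubgroup),
          (φ q).1 ⟨g, hg⟩ - φ₀.1 ⟨g, hg'⟩ = g • t - t := by
    intro q v
    have hv : ((p : ℕ) : 𝓞 K) ∈ v.1.asIdeal := by
      have := v.2; rw [Set.Finite.mem_toFinset] at this; exact this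
    set ι : AlgebraicClosure K →ₐ[K] AlgebraicClosure (v.1.adicCompletion K) :=
      closureEmb (K := K) (v.1.adicCompletion K) with hι
    have hmem : conjH1 κ.kerSubgroup (W.geomPrimaryTorsion p) q.out (W.layerToInfty κ n y) ∈
        localKummerOverOfEmb W p κ.kerSubgroup ι (signedLocalPointsInfty κ ι W ε) :=
      (mem_condAbove_sgn_iff W p κ v.1 ε _).1 (hsel.2 v.1 hv) q.out
    obtain ⟨φ₀, Q, k, hcl, hA, hτ⟩ := (mem_localKummerOverOfEmb_iff _ _).1 hmem
    have hA' : p ^ k • Q ∈ ⨆ n : ℕ, signedLocalPointsOfEmb κ ι W ε n := hA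
    obtain ⟨n₀, hn₀⟩ := (AddSubgroup.mem_iSup_of_directed
      (Summit.BirchSwinnertonDyer.Rank1Residual.Additive.signedLocalPointsOfEmb_mono κ ι W ε).directed_le).1
      hA'
    -- `res_{Γ_∞} [φ q] = [φ₀]`
    have hres : Literature.NumberTheory.EllipticCurves.resOfLe (W.geomPrimaryTorsion p)
        (κ.kerSubgroup_le_layerSubgroup n) (oneCocycleClass _ (φ q)) = oneCocycleClass _ φ₀ := by
      rw [hcl, hφ q]
      change W.layerToInfty κ n (W.conjH1 p (κ.layerSubgroup n) q.out y) = _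
      rw [W.layerToInfty_conjH1 κ]
    rw [Literature.NumberTheory.EllipticCurves.resOfLe, resH1Hom_oneCocycleClass] at hres
    have h0 := sub_eq_zero.mpr hres
    rw [← oneCocycleClass_sub, oneCocycleClass_eq_zero_iff] at h0
    obtain ⟨t, ht⟩ := h0
    refine ⟨n₀, φ₀, Q, k, t, hn₀, hτ, fun g hg hg' ↦ ?_⟩
    have h1 := ht ⟨g, hg'⟩
    rw [Submodule.coe_sub, ContinuousMap.sub_apply] at h1
    exact h1
  choose n₀ φ₀ Q k t hQA hQ ht using hK
  -- (5) ONE layer `m ≥ n` beyond all the `n₀`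
  obtain ⟨m, hnm, hm⟩ : ∃ m, n ≤ m ∧
      ∀ i : (absoluteGaloisGroup K ⧸ κ.layerSubgroup n) × hPfin.toFinset, n₀ i.1 i.2 ≤ m :=
    exists_forall_of_finite' n (fun _ _ _ hmm' h ↦ h.trans hmm')
      (fun i ↦ ⟨max n (n₀ i.1 i.2), le_max_left _ _, le_max_right _ _⟩)
  -- (6) the class at layer `m` and its conjugates
  have hym_inf : W.layerToInfty κ m (W.resOfLe p (κ.layerSubgroup_antitone hnm) y) =
      W.layerToInfty κ n y := by
    show W.resOfLe p _ (W.resOfLe p _ y) = W.resOfLe p _ y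
    rw [← AddMonoidHom.comp_apply, W.resOfLe_comp_holds p]
  have hconj_m : ∀ σ : absoluteGaloisGroup K,
      W.conjH1 p (κ.layerSubgroup m) σ (W.resOfLe p (κ.layerSubgroup_antitone hnm) y) =
        W.resOfLe p (κ.layerSubgroup_antitone hnm)
          (oneCocycleClass _ (φ (σ : absoluteGaloisGroup K ⧸ κ.layerSubgroup n))) := by
    intro σ
    rw [hφ, ← hconj_rep σ]
    exact (congrArg (fun f ↦ f y) (resOfLe_comp_conjH1_holds (M := W.geomPrimaryTorsion p)
      (κ.layerSubgroup_antitone hnm) σ)).symm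
  -- (7) the restricted class lies in `Sel^ε(E/K_m)`
  have hmem : W.resOfLe p (κ.layerSubgroup_antitone hnm) y ∈ signedSelmerLayer W κ ε m := by
    rw [mem_signedSelmerLayer_iff]
    refine ⟨W.resOfLe_mem_selmerGroupOver p (κ.layerSubgroup_antitone hnm) hy, fun v hv σ ↦ ?_⟩
    have hvP : v ∈ hPfin.toFinset := by rw [Set.Finite.mem_toFinset]; exact hv
    set q : absoluteGaloisGroup K ⧸ κ.layerSubgroup n := (σ : absoluteGaloisGroup K ⧸ κ.layerSubgroup n)
      with hq
    -- the classical Kummer datum of `conj_q y` at the place above `v` of `K_n`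
    have hcl : oneCocycleClass _ (φ q) ∈ W.localKerOver p (κ.layerSubgroup n) (v.adicCompletion K) := by
      rw [hφ q, ← hconj_rep]
      exact hy'.1 v σ
    obtain ⟨P, hP⟩ := (Summit.BirchSwinnertonDyer.Rank1Residual.X2.GreenbergVatsalSelmerLink.oneCocycleClass_mem_localKerOver_iff
      W p (κ.layerSubgroup n) (v.adicCompletion K) (φ q)).1 hcl
    rw [hconj_m σ]
    exact resOfLe_mem_localKummerOverOfEmb_of_kummer_data W κ hnm (hm ⟨q, ⟨v, hvP⟩⟩) (hNT' v hv) (φ q)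
      P hP (φ₀ q ⟨v, hvP⟩) (Q q ⟨v, hvP⟩) (k q ⟨v, hvP⟩) ε (hQA q ⟨v, hvP⟩) (hQ q ⟨v, hvP⟩)
      (t q ⟨v, hvP⟩) (ht q ⟨v, hvP⟩)
  -- (8) conclude
  rw [← hym_inf]
  exact map_layerToInfty_signedSelmerLayer_le W κ ε m ⟨_, hmem, rfl⟩

/-! ## §3 The identity of the two transcriptions -/

/-- **`Sel^{±}(K_∞)` in Kim's `K_∞`-level model EQUALS Kobayashi's `lim→ Sel^ε(E/K_n)`** (odd `p`, any
number field, any `ℤ_p`-extension, any elliptic `W`, under `E(K_{∞,w})[p^∞] = 0` at every `w ∣ p`): the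
reading flag `away-p` of `AnticyclotomicSignedSelmer.lean` discharged. [cite: Kobayashi2003, Def. 1.1]
[cite: BDKim2013, Def. 3.1, Def. 3.3 (p. 193)] [cite: IovitaPollack2006, Def. 6.7 and Lemma 2.1 (arXiv:math/0411496 pp. 5, 14)] -/
theorem selmer_sgn_eq_signedSelmerInfty [W.IsElliptic] (hp : p ≠ 2) (ε : ℤˣ)
    (hNT : ∀ v : HeightOneSpectrum (𝓞 K), ((p : ℕ) : 𝓞 K) ∈ v.asIdeal →
      FixedPoints.addSubgroup ↥(decomp v ⊓ κ.kerSubgroup) (W.geomPrimaryTorsion p) = ⊥) :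
    AcSigned.selmer W p κ ∅ (fun _ ↦ .sgn ε) = signedSelmerInfty W κ ε :=
  le_antisymm (selmer_sgn_le_signedSelmerInfty W κ ε hNT) (signedSelmerInfty_le_selmer_sgn W κ hp ε)

end Summit.BirchSwinnertonDyer.BirchSwinnertonDyer.Theorems.SignedBaseChangeAcDivXAcTorsionCarrier

end
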